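import Literature.AlgebraicGeometry.Motives.HodgeTensorMumfordTateGroupTateProofs
import HarnessLib

/-!
# Discharged fact: homotheties lie in the Mumford–Tate group (weight `≠ 0`)

`Literature.AlgebraicGeometry.Motives.HodgeTensor` records as a named fact
(`Literature.HodgeStructure.homothety_mem_mumfordTateGroup : Prop`) that for a pure `ℚ`-Hodge structure
`H` of weight `n ≠ 0` on a finite-dimensional `V`, every homothety `c • id` (`c ∈ ℚˣ`, as
`LinearEquiv.smulOfUnit c`) lies in the Mumford–Tate group `H.mumfordTateGroup ≤ GL(V)` (the
`ℚ`-points, stabiliser description: the subgroup of `V ≃ₗ[ℚ] V` fixing every rational tensor of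
weight `0` and type `(0,0)` in the tensor spaces `T^{a,b} V = V^{⊗a} ⊗ (V^∨)^{⊗b}`,
`(a - b) n = 0`). This file proves it
(`Literature.AlgebraicGeometry.Motives.HodgeStructure.homothety_mem_mumfordTateGroup_holds`), so the user holding
`(h : homothety_mem_mumfordTateGroup)` can discharge the hypothesis.

Source: Deligne, *Hodge cycles on abelian varieties* (notes by J. S. Milne), in LNM 900, I §3,
"Mumford–Tate groups": `GL(V)` acts on `T = V^{⊗m₁} ⊗ V^{∨⊗m₂}` factorwise (on `V^∨` by the
inverse transpose), the Mumford–Tate group `G ≤ GL(V) × 𝔾ₘ` is the subgroup fixing all rational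
tensors of type `(0,0)` belonging to any such `T`, and (Prop. 3.4) `G` is the smallest
`ℚ`-algebraic subgroup with `μ(𝔾ₘ) ⊂ G_ℂ`; since `h(λ) = λ^{-n} · id` for `λ ∈ ℝˣ` (loc. cit.,
Hodge structures of weight `n`), for `n ≠ 0` the image of `G` in `GL(V)` contains the
homotheties.

## Proof

The vendored statement is proved by the underlying elementary computation, with no appeal to
algebraic groups (the standing instance hypothesis `[HodgeTensorFacts]` of the constructions is
only carried, not used): the homothety `c • id` acts on `V^{⊗a}` by `c^a` (multilinearity in
all `a` factors, `Literature.AlgebraicGeometry.Motives.piTensorProduct_map_smul_id` of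
`Literature.AlgebraicGeometry.Motives.HodgeTensorMumfordTateGroupTateProofs`) and on `(V^∨)^{⊗b}`
by `c^{-b}` (its inverse transpose on `V^∨` is `c⁻¹ • id`), hence on `T^{a,b} V` by the scalar
`c^a · c^{-b}` (`Literature.AlgebraicGeometry.Motives.tensorSpaceAct_smulOfUnit`). The weight-`0` condition `(a - b) n = 0` with
`n ≠ 0` forces `a = b`, where this scalar is `1`; so `c • id` fixes every weight-`0` tensor, in
particular the Hodge tensors of type `(0,0)` defining `mumfordTateGroup`.

## Main results

* `Literature.AlgebraicGeometry.Motives.smulOfUnit_coe_eq_smul_id`, `Literature.AlgebraicGeometry.Motives.smulOfUnit_symm_dualMap_eq_smul_id`: the homothety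
  `LinearEquiv.smulOfUnit c` is `c • id`, and its inverse transpose on the dual is `c⁻¹ • id`
  (any commutative semiring).
* `Literature.AlgebraicGeometry.Motives.tensorSpaceAct_smulOfUnit`: `tensorSpaceAct (smulOfUnit c) t = (c^a · (c⁻¹)^b) • t` on
  `T^{a,b} V`.
* `Literature.AlgebraicGeometry.Motives.HodgeStructure.homothety_mem_mumfordTateGroup_holds`: the discharge.

## References

* P. Deligne, *Hodge cycles on abelian varieties* (notes by J. S. Milne), in: P. Deligne,
  J. S. Milne, A. Ogus, K.-y. Shih, *Hodge Cycles, Motives, and Shimura Varieties*, Lecture Notes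
  in Mathematics 900, Springer (1982), 9–100; I §3 "Mumford–Tate groups", the definition of the
  Mumford–Tate group (paragraph preceding Prop. 3.4) and Proposition 3.4.
  doi:10.1007/978-3-540-38955-2_2. [Deligne1982HodgeCycles]
-/

open scoped TensorProduct PiTensorProduct

noncomputable section

namespace Literature.AlgebraicGeometry.Motives

universe u

/-- The homothety `LinearEquiv.smulOfUnit c` of a module, as a linear map, is `c • id`.
[folklore] -/
theorem smulOfUnit_coe_eq_smul_id {R : Type*} [CommSemiring R] {M : Type*} [AddCommMonoid M]
    [Module R M] (c : Rˣ) :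
    ((LinearEquiv.smulOfUnit c : M ≃ₗ[R] M) : M →ₗ[R] M) = (c : R) • LinearMap.id := by
  ext v
  simp only [LinearEquiv.smulOfUnit, LinearEquiv.coe_coe, DistribMulAction.toLinearEquiv_apply,
    Units.smul_def, LinearMap.smul_apply, LinearMap.id_coe, id_eq]

/-- The inverse transpose of the homothety `c • id` of a module `M`, acting on the dual `M^∨`,
is the homothety `c⁻¹ • id` (Deligne, LNM 900, I §3: `g ∈ GL(V)` acts on `V^∨` by the inverse
transpose). [folklore] -/
theorem smulOfUnit_symm_dualMap_eq_smul_id {R : Type*} [CommSemiring R] {M : Type*}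
    [AddCommMonoid M] [Module R M] (c : Rˣ) :
    ((LinearEquiv.smulOfUnit c : M ≃ₗ[R] M).symm.dualMap : Module.Dual R M →ₗ[R] Module.Dual R M) =
      ((c⁻¹ : Rˣ) : R) • LinearMap.id := by
  ext φ v
  simp only [LinearEquiv.smulOfUnit, LinearEquiv.coe_coe, LinearEquiv.dualMap_apply,
    DistribMulAction.toLinearEquiv_symm_apply, Units.smul_def, map_smul, smul_eq_mul,
    LinearMap.smul_apply, LinearMap.id_coe, id_eq]

variable {V : Type u} [AddCommGroup V] [Module ℚ V]

/-- A homothety `c • id ∈ GL(V)` acts on `T^{a,b} V = V^{⊗a} ⊗ (V^∨)^{⊗b}` by the scalar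
`c ^ a · (c⁻¹) ^ b` (Deligne, LNM 900, I §3: the factorwise action of `GL(V)` on
`T = V^{⊗m₁} ⊗ V^{∨⊗m₂}`, `g` acting on `V^∨` by the inverse transpose). [folklore] -/
theorem tensorSpaceAct_smulOfUnit {a b : ℕ} (c : ℚˣ) (t : hodgeTensorSpace V a b) :
    tensorSpaceAct (LinearEquiv.smulOfUnit c) t = ((c : ℚ) ^ a * ((c⁻¹ : ℚˣ) : ℚ) ^ b) • t := by
  rw [← LinearEquiv.coe_coe, coe_tensorSpaceAct, smulOfUnit_coe_eq_smul_id,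
    smulOfUnit_symm_dualMap_eq_smul_id, piTensorProduct_map_smul_id, piTensorProduct_map_smul_id,
    TensorProduct.map_smul_left, TensorProduct.map_smul_right, TensorProduct.map_id, smul_smul,
    Fintype.card_fin, Fintype.card_fin, LinearMap.smul_apply, LinearMap.id_apply]

namespace HodgeStructure

variable {n : ℤ} [HodgeTensorFacts.{u, u}] [Module.Finite ℚ V]

/-- **Discharge of the named fact `homothety_mem_mumfordTateGroup`.** For a Hodge structure of
weight `n ≠ 0`, every homothety `c • id` (`c ∈ ℚˣ`) lies in the Mumford–Tate group (`ℚ`-points,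
stabiliser form): the weight-`0` tensor spaces are the balanced ones `T^{a,a} V`
(`(a - b) n = 0` with `n ≠ 0` forces `a = b`), on which `c • id` acts by `c^a · (c⁻¹)^a = 1`
(`tensorSpaceAct_smulOfUnit`), so it fixes every weight-`0` tensor, in particular those of type
`(0,0)`. This is the elementary content of Deligne, LNM 900, I §3: the Mumford–Tate group is the
subgroup of `GL(V) × 𝔾ₘ` fixing the rational tensors of type `(0,0)`, by Prop. 3.4 the smallest
`ℚ`-subgroup `G` with `μ(𝔾ₘ) ⊂ G_ℂ`, and `h(λ) = λ^{-n} · id` for `λ` real, so for `n ≠ 0` its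
image in `GL(V)` contains the homotheties.
[cite: Deligne1982HodgeCycles, I §3, definition of the Mumford–Tate group and Prop. 3.4] -/
theorem homothety_mem_mumfordTateGroup_holds :
    homothety_mem_mumfordTateGroup (V := V) (n := n) := by
  intro H hn c
  rw [mem_mumfordTateGroup_iff]
  intro a b hab t _
  obtain rfl : a = b := by
    have : (a : ℤ) - b = 0 := (mul_eq_zero.mp hab).resolve_right hn
    omega
  rw [tensorSpaceAct_smulOfUnit, ← mul_pow, Units.mul_inv, one_pow, one_smul]

end HodgeStructure

end Literature.AlgebraicGeometry.Motives

end
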